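import Mathlib.Analysis.InnerProductSpace.Calculus
import Mathlib.Analysis.Calculus.Deriv.Mul
import Literature.Geometry.Lorentzian.KerrTimelikeSpan
import HarnessLib

/-!
# The separated current templates `Q^f`, `Ϙ^h`, `ϟ^y`, `Q^T`, `Q^K` for Carter's radial ODE
# and their derivative identities (Dafermos–Rodnianski–Shlapentokh-Rothman, §7)

(family `gr`, infrastructure for statement **gr.S24**; namespace `Literature.Geometry.Lorentzian.Kerr`)

Dafermos–Rodnianski–Shlapentokh-Rothman (*Decay for solutions of the wave equation on Kerr
exterior spacetimes III*, arXiv:1402.7034 = Ann. of Math. 183 (2016), §7) fix frequency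
parameters `(ω, m, Λ)` and, for a smooth complex function `u(r*)` and real weight functions
`f`, `h`, `y` of `r*`, define the **frequency-localised virial currents** (§7.1)
`Q^f[u] = f(|u'|² + (ω² − V)|u|²) + f' Re(u'ū) − ½ f''|u|²`, `Ϙ^h[u] = h Re(u'ū) − ½ h'|u|²`,
`ϟ^y[u] = y(|u'|² + (ω² − V)|u|²)`, and the **frequency-localised conserved energy currents**
(§7.2) `Q^T[u] = ω Im(u'ū)`, `Q^K[u] = (ω − ω₊m) Im(u'ū)`, `ω₊ = a/(2Mr₊)`. For `u` solving the
radial ODE `u'' + (ω² − V)u = H` of loc. cit. §5.2.3 (here: the pointwise hypothesis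
`u''(x) + (ω² − V(x))u(x) = H(x)` at the point considered) they record the identities
`(Q^f)' = 2f'|u'|² − fV'|u|² + Re(2fH̄u' + f'H̄u) − ½f'''|u|²`,
`(Ϙ^h)' = h(|u'|² + (V − ω²)|u|²) − ½h''|u|² + h Re(uH̄)`,
`(ϟ^y)' = y'(|u'|² + (ω² − V)|u|²) − yV'|u|² + 2y Re(u'H̄)` (§7.1, the three displays following
the definitions) and `(Q^T)' = ω Im(Hū)`, `(Q^K)' = (ω − ω₊m) Im(Hū)` (§7.2), on which every
multiplier estimate of their §8 (Theorem 8.1) is built. This file transcribes the five currents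
as real functions of `x = r*` and **proves** the five identities as `HasDerivAt` statements at a
point, for arbitrary functions `V, f, h, y : ℝ → ℝ`, `u, u' : ℝ → ℂ` with the stated
derivatives there.

## Design choices

* `|z|² = ‖z‖²` and `Re(z w̄) = ⟪w, z⟫_ℝ` (`Complex.inner`: `⟪w, z⟫_ℝ = Re(z w̄)`), so that
  Mathlib's `HasDerivAt.norm_sq` / `HasDerivAt.inner` apply; `Im(u'ū)` is kept literally as
  `(u' * conj u).im` in `Q^T`, `Q^K` and converted to `⟪i u, u'⟫_ℝ` inside the proofs
  (`im_mul_conj_eq_inner`).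
* The derivative data are pointwise: `u₁ = u'` as a function (it enters the currents) with
  `HasDerivAt u (u₁ x) x`, and `u₂ = u''(x)`, `H = H(x)` as numbers with the ODE
  `u₂ + (ω² − V(x)) u(x) = H` at `x`; likewise `f₁ = f'`, `f₂ = f''` as functions with
  `HasDerivAt f (f₁ x) x`, `HasDerivAt f₁ (f₂ x) x`, `HasDerivAt f₂ f₃ x`. Nothing is assumed about
  `V` beyond `HasDerivAt V V' x`; in loc. cit. `V = V₀ + V₁` is the potential of
  `KerrSeparatedPotential.lean`, and `ω₊ = a/(2Mr₊)` is `Kerr.horizonAngularVelocity` of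
  `KerrTimelikeSpan.lean` (`energyCurrentK_eq` writes it out).

## References

* M. Dafermos, I. Rodnianski, Y. Shlapentokh-Rothman, arXiv:1402.7034 = Ann. of Math. 183 (2016),
  §7.1 (`Q^f`, `Ϙ^h`, `ϟ^y` and their derivatives), §7.2 (`Q^T`, `Q^K` and their derivatives),
  §5.2.3 (the radial ODE) (key `DafermosRodnianskiShlapentokhrothman2014`).
-/

noncomputable section

open scoped InnerProductSpace ComplexConjugate

namespace Literature.Geometry.Lorentzian

namespace Kerr

/-! ### The currents -/

/-- The current **`ϟ^y[u] = y (|u'|² + (ω² − V)|u|²)`** (DRSR arXiv:1402.7034, §7.1), as a real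
function of `x = r*`, for `u` with derivative function `u₁ = u'`. [cite: DafermosRodnianskiShlapentokhrothman2014, §7.1] -/
def koppaCurrent (ω : ℝ) (V y : ℝ → ℝ) (u u₁ : ℝ → ℂ) (x : ℝ) : ℝ :=
  y x * (‖u₁ x‖ ^ 2 + (ω ^ 2 - V x) * ‖u x‖ ^ 2)

/-- The current **`Ϙ^h[u] = h Re(u'ū) − ½ h' |u|²`** (DRSR arXiv:1402.7034, §7.1), for `u` with
derivative function `u₁ = u'` and `h` with derivative function `h₁ = h'`; `Re(u'ū) = ⟪u, u'⟫_ℝ`.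
[cite: DafermosRodnianskiShlapentokhrothman2014, §7.1] -/
def qoppaCurrent (h h₁ : ℝ → ℝ) (u u₁ : ℝ → ℂ) (x : ℝ) : ℝ :=
  h x * ⟪u x, u₁ x⟫_ℝ - 1 / 2 * h₁ x * ‖u x‖ ^ 2

/-- The **virial current `Q^f[u] = f(|u'|² + (ω² − V)|u|²) + f' Re(u'ū) − ½ f''|u|²`**
(DRSR arXiv:1402.7034, §7.1; `Q^f = ϟ^f + Ϙ^{f'}`), for `u` with derivative function `u₁ = u'`
and `f` with derivative functions `f₁ = f'`, `f₂ = f''`. [cite: DafermosRodnianskiShlapentokhrothman2014, §7.1] -/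
def virialCurrent (ω : ℝ) (V f f₁ f₂ : ℝ → ℝ) (u u₁ : ℝ → ℂ) (x : ℝ) : ℝ :=
  f x * (‖u₁ x‖ ^ 2 + (ω ^ 2 - V x) * ‖u x‖ ^ 2) + f₁ x * ⟪u x, u₁ x⟫_ℝ -
    1 / 2 * f₂ x * ‖u x‖ ^ 2

/-- `Q^f = ϟ^f + Ϙ^{f'}` (DRSR arXiv:1402.7034, §7.1, footnote). [cite: DafermosRodnianskiShlapentokhrothman2014, §7.1] -/
theorem virialCurrent_eq (ω : ℝ) (V f f₁ f₂ : ℝ → ℝ) (u u₁ : ℝ → ℂ) (x : ℝ) :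
    virialCurrent ω V f f₁ f₂ u u₁ x = koppaCurrent ω V f u u₁ x + qoppaCurrent f₁ f₂ u u₁ x := by
  simp only [virialCurrent, koppaCurrent, qoppaCurrent]
  ring

/-- The **frequency-localised `T`-energy current `Q^T[u] = ω Im(u'ū)`** (DRSR arXiv:1402.7034,
§7.2). [cite: DafermosRodnianskiShlapentokhrothman2014, §7.2] -/
def energyCurrentT (ω : ℝ) (u u₁ : ℝ → ℂ) (x : ℝ) : ℝ :=
  ω * (u₁ x * conj (u x)).im

/-- The **frequency-localised `K`-energy current `Q^K[u] = (ω − ω₊ m) Im(u'ū)`**, with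
`ω₊ = a/(2Mr₊)` the angular velocity of the horizon (`Kerr.horizonAngularVelocity` of
`KerrTimelikeSpan.lean`). DRSR arXiv:1402.7034, §7.2. [cite: DafermosRodnianskiShlapentokhrothman2014, §7.2] -/
def energyCurrentK (M a ω : ℝ) (m : ℤ) (u u₁ : ℝ → ℂ) (x : ℝ) : ℝ :=
  (ω - horizonAngularVelocity M a * m) * (u₁ x * conj (u x)).im

/-- `Q^K[u]` with `ω₊ = a/(2Mr₊)` written out (by `rfl`). DRSR arXiv:1402.7034, §7.2 with §2.2.2.
[cite: DafermosRodnianskiShlapentokhrothman2014, §7.2] -/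
theorem energyCurrentK_eq (M a ω : ℝ) (m : ℤ) (u u₁ : ℝ → ℂ) (x : ℝ) :
    energyCurrentK M a ω m u u₁ x = (ω - a / (2 * M * rPlus M a) * m) * (u₁ x * conj (u x)).im :=
  rfl

/-- `Q^K = Q^T − ω₊ m Im(u'ū)`, i.e. `Q^K[u] = ((ω − ω₊m)/ω) Q^T[u]` cleared of the division:
`ω Q^K[u] = (ω − ω₊ m) Q^T[u]`. DRSR arXiv:1402.7034, §7.2. [cite: DafermosRodnianskiShlapentokhrothman2014, §7.2] -/
theorem omega_mul_energyCurrentK (M a ω : ℝ) (m : ℤ) (u u₁ : ℝ → ℂ) (x : ℝ) :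
    ω * energyCurrentK M a ω m u u₁ x =
      (ω - horizonAngularVelocity M a * m) * energyCurrentT ω u u₁ x := by
  simp only [energyCurrentK, energyCurrentT]
  ring

/-! ### Complex bookkeeping -/

/-- `Re(z w̄) = ⟪w, z⟫_ℝ` (Mathlib's `Complex.inner`, restated in the orientation used here):
bookkeeping API for users of the currents, who will meet the printed `Re(u'ū)`; not needed below.
[folklore] -/
theorem re_mul_conj_eq_inner (z w : ℂ) : (z * conj w).re = ⟪w, z⟫_ℝ :=
  (Complex.inner w z).symm

/-- `Im(z w̄) = ⟪i w, z⟫_ℝ` (`= Re(z · conj(i w)) = Re(−i z w̄)`). [folklore] -/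
theorem im_mul_conj_eq_inner (z w : ℂ) : (z * conj w).im = ⟪Complex.I * w, z⟫_ℝ := by
  rw [Complex.inner, map_mul, Complex.conj_I]
  simp only [Complex.mul_re, Complex.mul_im, Complex.neg_re, Complex.neg_im, Complex.I_re,
    Complex.I_im, Complex.conj_re, Complex.conj_im, neg_mul]
  ring

/-- `⟪w, (r : ℂ) z⟫_ℝ = r ⟪w, z⟫_ℝ` for real `r` (real-linearity in the second slot). [folklore] -/
theorem inner_ofReal_mul (w z : ℂ) (r : ℝ) : ⟪w, (r : ℂ) * z⟫_ℝ = r * ⟪w, z⟫_ℝ := by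
  rw [← Complex.real_smul, real_inner_smul_right]

/-- `⟪(r : ℂ) w, z⟫_ℝ = r ⟪w, z⟫_ℝ` for real `r` (companion of `inner_ofReal_mul` in the first
slot; bookkeeping API for users of the currents, not needed below). [folklore] -/
theorem inner_ofReal_mul_left (w z : ℂ) (r : ℝ) : ⟪(r : ℂ) * w, z⟫_ℝ = r * ⟪w, z⟫_ℝ := by
  rw [← Complex.real_smul, real_inner_smul_left]

/-- `⟪i z, z⟫_ℝ = 0` (`Re(z · conj(iz)) = Re(−i|z|²) = 0`). [folklore] -/
theorem inner_I_mul_self (z : ℂ) : ⟪Complex.I * z, z⟫_ℝ = 0 := by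
  rw [← im_mul_conj_eq_inner, Complex.mul_conj]
  simp

/-! ### The derivative identities of §7.1–§7.2 -/

section Identities

variable {ω V' y' h₂ f₃ x : ℝ} {V y h h₁ f f₁ f₂ : ℝ → ℝ} {u u₁ : ℝ → ℂ} {u₂ H : ℂ}

/-- **`(ϟ^y)'`**: for `u'' + (ω² − V)u = H` at `x`,
`(ϟ^y[u])' = y'(|u'|² + (ω² − V)|u|²) − yV'|u|² + 2y Re(u'H̄)` (`Re(u'H̄) = ⟪H, u'⟫_ℝ`).
DRSR arXiv:1402.7034, §7.1, third display. [cite: DafermosRodnianskiShlapentokhrothman2014, §7.1] -/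
theorem hasDerivAt_koppaCurrent (hV : HasDerivAt V V' x) (hy : HasDerivAt y y' x)
    (hu : HasDerivAt u (u₁ x) x) (hu₁ : HasDerivAt u₁ u₂ x)
    (hode : u₂ + ((ω ^ 2 - V x : ℝ) : ℂ) * u x = H) :
    HasDerivAt (koppaCurrent ω V y u u₁)
      (y' * (‖u₁ x‖ ^ 2 + (ω ^ 2 - V x) * ‖u x‖ ^ 2) - y x * V' * ‖u x‖ ^ 2 +
        2 * y x * ⟪H, u₁ x⟫_ℝ) x := by
  have hE : HasDerivAt (fun t ↦ ‖u₁ t‖ ^ 2 + (ω ^ 2 - V t) * ‖u t‖ ^ 2)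
      (2 * ⟪u₁ x, u₂⟫_ℝ + ((0 - V') * ‖u x‖ ^ 2 + (ω ^ 2 - V x) * (2 * ⟪u x, u₁ x⟫_ℝ))) x :=
    hu₁.norm_sq.add (((hasDerivAt_const x (ω ^ 2)).sub hV).mul hu.norm_sq)
  have hk : HasDerivAt (koppaCurrent ω V y u u₁)
      (y' * (‖u₁ x‖ ^ 2 + (ω ^ 2 - V x) * ‖u x‖ ^ 2) +
        y x * (2 * ⟪u₁ x, u₂⟫_ℝ + ((0 - V') * ‖u x‖ ^ 2 + (ω ^ 2 - V x) * (2 * ⟪u x, u₁ x⟫_ℝ)))) x :=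
    hy.mul hE
  refine hk.congr_deriv ?_
  have hu₂ : u₂ = H - ((ω ^ 2 - V x : ℝ) : ℂ) * u x := eq_sub_of_add_eq hode
  rw [hu₂, inner_sub_right, inner_ofReal_mul, real_inner_comm (u x) (u₁ x),
    real_inner_comm H (u₁ x)]
  ring

/-- **`(Ϙ^h)'`**: for `u'' + (ω² − V)u = H` at `x`,
`(Ϙ^h[u])' = h(|u'|² + (V − ω²)|u|²) − ½h''|u|² + h Re(uH̄)` (`Re(uH̄) = ⟪H, u⟫_ℝ`).
DRSR arXiv:1402.7034, §7.1, second display. [cite: DafermosRodnianskiShlapentokhrothman2014, §7.1] -/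
theorem hasDerivAt_qoppaCurrent (hh : HasDerivAt h (h₁ x) x) (hh₁ : HasDerivAt h₁ h₂ x)
    (hu : HasDerivAt u (u₁ x) x) (hu₁ : HasDerivAt u₁ u₂ x)
    (hode : u₂ + ((ω ^ 2 - V x : ℝ) : ℂ) * u x = H) :
    HasDerivAt (qoppaCurrent h h₁ u u₁)
      (h x * (‖u₁ x‖ ^ 2 + (V x - ω ^ 2) * ‖u x‖ ^ 2) - 1 / 2 * h₂ * ‖u x‖ ^ 2 +
        h x * ⟪H, u x⟫_ℝ) x := by
  have h1 : HasDerivAt (fun t ↦ h t * ⟪u t, u₁ t⟫_ℝ)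
      (h₁ x * ⟪u x, u₁ x⟫_ℝ + h x * (⟪u x, u₂⟫_ℝ + ⟪u₁ x, u₁ x⟫_ℝ)) x :=
    hh.mul (hu.inner ℝ hu₁)
  have h2 : HasDerivAt (fun t ↦ 1 / 2 * h₁ t * ‖u t‖ ^ 2)
      (1 / 2 * h₂ * ‖u x‖ ^ 2 + 1 / 2 * h₁ x * (2 * ⟪u x, u₁ x⟫_ℝ)) x :=
    (hh₁.const_mul (1 / 2)).mul hu.norm_sq
  have hq : HasDerivAt (qoppaCurrent h h₁ u u₁)
      (h₁ x * ⟪u x, u₁ x⟫_ℝ + h x * (⟪u x, u₂⟫_ℝ + ⟪u₁ x, u₁ x⟫_ℝ) -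
        (1 / 2 * h₂ * ‖u x‖ ^ 2 + 1 / 2 * h₁ x * (2 * ⟪u x, u₁ x⟫_ℝ))) x :=
    h1.sub h2
  refine hq.congr_deriv ?_
  have hu₂ : u₂ = H - ((ω ^ 2 - V x : ℝ) : ℂ) * u x := eq_sub_of_add_eq hode
  rw [hu₂, inner_sub_right, inner_ofReal_mul, real_inner_self_eq_norm_sq,
    real_inner_self_eq_norm_sq, real_inner_comm H (u x)]
  ring

/-- **`(Q^f)'`**: for `u'' + (ω² − V)u = H` at `x`,
`(Q^f[u])' = 2f'|u'|² − fV'|u|² + Re(2fH̄u' + f'H̄u) − ½f'''|u|²`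
(`Re(2fH̄u' + f'H̄u) = 2f⟪H, u'⟫_ℝ + f'⟪H, u⟫_ℝ`). DRSR arXiv:1402.7034, §7.1, first display.
[cite: DafermosRodnianskiShlapentokhrothman2014, §7.1] -/
theorem hasDerivAt_virialCurrent (hV : HasDerivAt V V' x) (hf : HasDerivAt f (f₁ x) x)
    (hf₁ : HasDerivAt f₁ (f₂ x) x) (hf₂ : HasDerivAt f₂ f₃ x)
    (hu : HasDerivAt u (u₁ x) x) (hu₁ : HasDerivAt u₁ u₂ x)
    (hode : u₂ + ((ω ^ 2 - V x : ℝ) : ℂ) * u x = H) :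
    HasDerivAt (virialCurrent ω V f f₁ f₂ u u₁)
      (2 * f₁ x * ‖u₁ x‖ ^ 2 - f x * V' * ‖u x‖ ^ 2 +
        (2 * f x * ⟪H, u₁ x⟫_ℝ + f₁ x * ⟪H, u x⟫_ℝ) - 1 / 2 * f₃ * ‖u x‖ ^ 2) x := by
  have hv := (hasDerivAt_koppaCurrent hV hf hu hu₁ hode).add
    (hasDerivAt_qoppaCurrent hf₁ hf₂ hu hu₁ hode)
  have hfun : (koppaCurrent ω V f u u₁ + qoppaCurrent f₁ f₂ u u₁) =
      virialCurrent ω V f f₁ f₂ u u₁ := by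
    funext t
    rw [Pi.add_apply, virialCurrent_eq]
  rw [hfun] at hv
  refine hv.congr_deriv ?_
  ring

/-- **`(Q^T)'`**: for `u'' + (ω² − V)u = H` at `x`, `(Q^T[u])' = ω Im(Hū)`. DRSR
arXiv:1402.7034, §7.2, first derivative display. [cite: DafermosRodnianskiShlapentokhrothman2014, §7.2] -/
theorem hasDerivAt_energyCurrentT (hu : HasDerivAt u (u₁ x) x) (hu₁ : HasDerivAt u₁ u₂ x)
    (hode : u₂ + ((ω ^ 2 - V x : ℝ) : ℂ) * u x = H) :
    HasDerivAt (energyCurrentT ω u u₁) (ω * (H * conj (u x)).im) x := by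
  have hIu : HasDerivAt (fun t ↦ Complex.I * u t) (Complex.I * u₁ x) x := hu.const_mul _
  have h1 : HasDerivAt (fun t ↦ ⟪Complex.I * u t, u₁ t⟫_ℝ)
      (⟪Complex.I * u x, u₂⟫_ℝ + ⟪Complex.I * u₁ x, u₁ x⟫_ℝ) x :=
    hIu.inner ℝ hu₁
  have hfun : (fun t ↦ ω * ⟪Complex.I * u t, u₁ t⟫_ℝ) = energyCurrentT ω u u₁ := by
    funext t
    rw [energyCurrentT, im_mul_conj_eq_inner]
  have hT : HasDerivAt (energyCurrentT ω u u₁)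
      (ω * (⟪Complex.I * u x, u₂⟫_ℝ + ⟪Complex.I * u₁ x, u₁ x⟫_ℝ)) x := hfun ▸ h1.const_mul ω
  refine hT.congr_deriv ?_
  have hu₂ : u₂ = H - ((ω ^ 2 - V x : ℝ) : ℂ) * u x := eq_sub_of_add_eq hode
  rw [hu₂, inner_sub_right, inner_ofReal_mul, inner_I_mul_self, inner_I_mul_self,
    im_mul_conj_eq_inner]
  ring

/-- **`(Q^K)'`**: for `u'' + (ω² − V)u = H` at `x`, `(Q^K[u])' = (ω − ω₊m) Im(Hū)`.
DRSR arXiv:1402.7034, §7.2, second derivative display. [cite: DafermosRodnianskiShlapentokhrothman2014, §7.2] -/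
theorem hasDerivAt_energyCurrentK {M a : ℝ} {m : ℤ} (hu : HasDerivAt u (u₁ x) x)
    (hu₁ : HasDerivAt u₁ u₂ x) (hode : u₂ + ((ω ^ 2 - V x : ℝ) : ℂ) * u x = H) :
    HasDerivAt (energyCurrentK M a ω m u u₁)
      ((ω - horizonAngularVelocity M a * m) * (H * conj (u x)).im) x := by
  have hIu : HasDerivAt (fun t ↦ Complex.I * u t) (Complex.I * u₁ x) x := hu.const_mul _
  have h1 : HasDerivAt (fun t ↦ ⟪Complex.I * u t, u₁ t⟫_ℝ)
      (⟪Complex.I * u x, u₂⟫_ℝ + ⟪Complex.I * u₁ x, u₁ x⟫_ℝ) x :=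
    hIu.inner ℝ hu₁
  have hfun : (fun t ↦ (ω - horizonAngularVelocity M a * m) * ⟪Complex.I * u t, u₁ t⟫_ℝ) =
      energyCurrentK M a ω m u u₁ := by
    funext t
    rw [energyCurrentK, im_mul_conj_eq_inner]
  have hK : HasDerivAt (energyCurrentK M a ω m u u₁)
      ((ω - horizonAngularVelocity M a * m) *
        (⟪Complex.I * u x, u₂⟫_ℝ + ⟪Complex.I * u₁ x, u₁ x⟫_ℝ)) x := hfun ▸ h1.const_mul _
  refine hK.congr_deriv ?_
  have hu₂ : u₂ = H - ((ω ^ 2 - V x : ℝ) : ℂ) * u x := eq_sub_of_add_eq hode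
  rw [hu₂, inner_sub_right, inner_ofReal_mul, inner_I_mul_self, inner_I_mul_self,
    im_mul_conj_eq_inner]
  ring

end Identities

end Kerr

end Literature.Geometry.Lorentzian

end
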